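import Mathlib.Analysis.Complex.ExponentialBounds
import Literature.Analysis.FluidPDE.CompressibleEulerImplosionP0ToPs
import HarnessLib

/-!
# Buckmaster–Cao-Labora–Gómez-Serrano at γ = 5/3: the far field of the `P₀` solution, uniformly in `r`

For the shooting argument of §6 of the paper the smooth solution issued from `P₀` (Prop. 2.5) has
to be controlled *uniformly* for `r` in a compact window. Here: for `r ∈ [11/10, 28/25]` and
`A = 1` the constants of the origin series `𝒲 = profile r 1` of
`CompressibleEulerImplosionOriginSeries` are bounded explicitly (`M ≤ 112`, `K ≤ 6/5`, radius
`≥ 1/224`), the profile satisfies the uniform second-order Taylor estimate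
`|𝒲(ζ) − 1 − (1 − r)ζ| ≤ 2KM²ζ²` inside the radius, and consequently the explicit germ
`ξ ↦ (W, Z)(ξ) = (e^{−ξ}𝒲(e^ξ), −e^{−ξ}𝒲(−e^ξ))` of the `P₀` trajectory satisfies, for EVERY
`ξ ≤ −16` and every such `r`: `D_W > 0`, `D_Z ≤ −1`, `W ≥ 20`, `W ≥ W₀`, the triangle
condition `(W − W₀) + (Z − Z₀) ≥ 0` of Prop. 2.5, and solves (1.8) in resolved form
(`germ_hasDerivAt`). This is the quantitative form of `Monatomic.eventually_entry`.

[cite: BuckmasterCaolaboraGomezserrano2025, Prop. 2.5 (proof), §6]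
-/

noncomputable section

open Set Filter Topology

namespace Literature.Analysis.FluidPDE

namespace BuckmasterCaolaboraGomezserrano2025

namespace Monatomic

namespace Germ

open OriginSeries

variable {r : ℝ}

/-! ### Uniform constants of the origin series on `r ∈ [11/10, 28/25]`, `A = 1` -/

/-- [folklore] -/
theorem B0_eq (r : ℝ) : B0 r 1 = |1 - r| + 1 := by
  unfold B0; rw [w_one one_ne_zero]

/-- [folklore] -/
theorem K0_eq (r : ℝ) : K0 r 1 = |1 - r| + 1 := by
  unfold K0; rw [B0_eq, abs_one]
  exact max_eq_right (by have := abs_nonneg (1 - r); linarith)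

/-- `K ≤ 6/5`. [folklore] -/
theorem K0_le (h1 : 1 ≤ r) (h2 : r ≤ 28 / 25) : K0 r 1 ≤ 6 / 5 := by
  rw [K0_eq, abs_of_nonpos (by linarith)]; linarith

/-- [folklore] -/
theorem one_le_K0 (r : ℝ) : 1 ≤ K0 r 1 := by
  rw [K0_eq]; have := abs_nonneg (1 - r); linarith

/-- `M ≤ 112`. [folklore] -/
theorem M0_le (h1 : 1 ≤ r) (h2 : r ≤ 28 / 25) : M0 r 1 ≤ 112 := by
  have hC : C0 r 1 ≤ 23 / 5 := by
    unfold C0; rw [abs_one, div_one, abs_of_nonneg (by linarith)]; linarith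
  have hB : B0 r 1 ≤ 6 / 5 := by rw [B0_eq, abs_of_nonpos (by linarith)]; linarith
  have hC0 := C0_nonneg (r := r) (A := (1 : ℝ))
  have hB0 := B0_pos (r := r) (A := (1 : ℝ))
  have hL : L0 r 1 ≤ 28 := by
    unfold L0
    nlinarith
  unfold M0; linarith

/-- The radius is at least `1/224`. [folklore] -/
theorem rad_ge (h1 : 1 ≤ r) (h2 : r ≤ 28 / 25) : 1 / 224 ≤ rad r 1 := by
  unfold rad
  have hM := M0_pos (r := r) (A := (1 : ℝ))
  have hM' := M0_le h1 h2
  rw [div_le_div_iff₀ (by norm_num) (by positivity)]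
  nlinarith

/-! ### The uniform second-order Taylor estimate of the profile -/

/-- `|𝒲(ζ) − A − w₁ ζ| ≤ 2 K M² ζ²` inside the radius. [cite: BuckmasterCaolaboraGomezserrano2025, Prop. 2.5 (proof)] -/
theorem abs_profile_sub_le {A : ℝ} (hA : A ≠ 0) {ζ : ℝ} (hζ : |ζ| < rad r A) :
    |profile r A ζ - A - w r A 1 * ζ| ≤ 2 * K0 r A * M0 r A ^ 2 * ζ ^ 2 := by
  have hK := (K0_pos (r := r) (A := A)).le
  have hM := (M0_pos (r := r) (A := A)).le
  have hs := hasSum_profile hA hζ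
  have h2 := (hasSum_nat_add_iff' 2).mpr hs
  simp only [Finset.sum_range_succ, Finset.sum_range_zero, zero_add, pow_zero, mul_one, pow_one,
    w_zero] at h2
  -- comparison series
  have hq : M0 r A * |ζ| ≤ 1 / 2 := M0_mul_abs_le hζ
  have hgeo : HasSum (fun m : ℕ => (1 / 2 : ℝ) ^ m) 2 := by
    have h := hasSum_geometric_of_lt_one (by norm_num : (0 : ℝ) ≤ 1 / 2) (by norm_num)
    norm_num at h
    exact h
  have hg : HasSum (fun m : ℕ => K0 r A * M0 r A ^ 2 * ζ ^ 2 * (1 / 2 : ℝ) ^ m)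
      (K0 r A * M0 r A ^ 2 * ζ ^ 2 * 2) := hgeo.mul_left _
  have hb : ∀ m : ℕ, ‖w r A (m + 2) * ζ ^ (m + 2)‖ ≤ K0 r A * M0 r A ^ 2 * ζ ^ 2 * (1 / 2 : ℝ) ^ m := by
    intro m
    rw [Real.norm_eq_abs, abs_mul, abs_pow]
    have hw := abs_w_le (r := r) hA (m + 2)
    calc |w r A (m + 2)| * |ζ| ^ (m + 2) ≤ K0 r A * M0 r A ^ (m + 2) * |ζ| ^ (m + 2) := by gcongr
      _ = K0 r A * M0 r A ^ 2 * |ζ| ^ 2 * (M0 r A * |ζ|) ^ m := by ring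
      _ ≤ K0 r A * M0 r A ^ 2 * |ζ| ^ 2 * (1 / 2 : ℝ) ^ m := by
          gcongr
      _ = K0 r A * M0 r A ^ 2 * ζ ^ 2 * (1 / 2 : ℝ) ^ m := by rw [sq_abs]
  have key := HasSum.norm_le_of_bounded h2 hg hb
  rw [Real.norm_eq_abs] at key
  have e : profile r A ζ - A - w r A 1 * ζ = profile r A ζ - (A + w r A 1 * ζ) := by ring
  rw [e]
  calc |profile r A ζ - (A + w r A 1 * ζ)| ≤ K0 r A * M0 r A ^ 2 * ζ ^ 2 * 2 := key
    _ = 2 * K0 r A * M0 r A ^ 2 * ζ ^ 2 := by ring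

/-- The uniform estimate at `A = 1`, `r ∈ [11/10, 28/25]`, `|ζ| ≤ 1/224`:
`|𝒲(ζ) − 1 − (1 − r)ζ| ≤ 30106 ζ²`. [cite: BuckmasterCaolaboraGomezserrano2025, Prop. 2.5 (proof)] -/
theorem abs_profile_one_sub_le (h1 : 11 / 10 ≤ r) (h2 : r ≤ 28 / 25) {ζ : ℝ} (hζ : |ζ| < 1 / 224) :
    |profile r 1 ζ - 1 - (1 - r) * ζ| ≤ 30106 * ζ ^ 2 := by
  have h1' : (1 : ℝ) ≤ r := by linarith
  have hζ' : |ζ| < rad r 1 := hζ.trans_le (rad_ge h1' h2)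
  have h := abs_profile_sub_le (r := r) one_ne_zero hζ'
  rw [w_one one_ne_zero] at h
  have hK := K0_le h1' h2
  have hK0 := one_le_K0 r
  have hM := M0_le h1' h2
  have hM0 := (M0_pos (r := r) (A := (1 : ℝ))).le
  have hz : 0 ≤ ζ ^ 2 := sq_nonneg ζ
  calc |profile r 1 ζ - 1 - (1 - r) * ζ| ≤ 2 * K0 r 1 * M0 r 1 ^ 2 * ζ ^ 2 := h
    _ ≤ 2 * (6 / 5) * 112 ^ 2 * ζ ^ 2 := by gcongr
    _ ≤ 30106 * ζ ^ 2 := by nlinarith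

/-! ### The germ of the `P₀` trajectory for `ξ ≤ −16` -/

/-- The explicit germ `(W, Z)(ξ)` of the solution issued from `P₀` (with `A = 1`).
[cite: BuckmasterCaolaboraGomezserrano2025, Prop. 2.5] -/
def germ (r ξ : ℝ) : ℝ × ℝ := (WofProfile (profile r 1) ξ, ZofProfile (profile r 1) ξ)

/-- [folklore] -/
theorem germ_fst (r ξ : ℝ) : (germ r ξ).1 = Real.exp (-ξ) * profile r 1 (Real.exp ξ) := rfl

/-- [folklore] -/
theorem germ_snd (r ξ : ℝ) : (germ r ξ).2 = -Real.exp (-ξ) * profile r 1 (-Real.exp ξ) := rfl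

/-- The anchor time `ξ_A = −16`. [folklore] -/
def ξA : ℝ := -16

/-- [folklore] -/
theorem exp_ξA_lt : Real.exp ξA < 1 / 8000000 := by
  unfold ξA
  have h1 : (2.7182818283 : ℝ) < Real.exp 1 := Real.exp_one_gt_d9
  have h2 : (2.7182818283 : ℝ) ^ 16 < Real.exp 1 ^ 16 := by gcongr
  have h3 : (8000000 : ℝ) < (2.7182818283 : ℝ) ^ 16 := by norm_num
  have h16 : Real.exp 1 ^ 16 = Real.exp 16 := by rw [← Real.exp_nat_mul]; norm_num
  have hgt : (8000000 : ℝ) < Real.exp 16 := by rw [← h16]; linarith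
  rw [Real.exp_neg, inv_eq_one_div, div_lt_div_iff₀ (Real.exp_pos _) (by norm_num)]
  linarith

/-- For `ξ ≤ ξ_A`: `0 < e^ξ < 1/8000000`. [folklore] -/
theorem exp_lt_of_le {ξ : ℝ} (hξ : ξ ≤ ξA) : Real.exp ξ < 1 / 8000000 :=
  (Real.exp_le_exp.mpr hξ).trans_lt exp_ξA_lt

/-- The basic decomposition: with `x = e^ξ`, `W = 1/x + (1 − r) + E₊`, `Z = −1/x + (1 − r) − E₋`,
`|E±| ≤ 30106·x`. [cite: BuckmasterCaolaboraGomezserrano2025, Prop. 2.5 (proof)] -/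
theorem germ_decomp (h1 : 11 / 10 ≤ r) (h2 : r ≤ 28 / 25) {ξ : ℝ} (hξ : ξ ≤ ξA) :
    ∃ Ep Em : ℝ, |Ep| ≤ 30106 * Real.exp ξ ∧ |Em| ≤ 30106 * Real.exp ξ ∧
      (germ r ξ).1 = 1 / Real.exp ξ + (1 - r) + Ep ∧
      (germ r ξ).2 = -(1 / Real.exp ξ) + (1 - r) - Em := by
  set x : ℝ := Real.exp ξ with hx
  have hxpos : 0 < x := Real.exp_pos ξ
  have hxlt : x < 1 / 8000000 := exp_lt_of_le hξ
  have hxabs : |x| < 1 / 224 := by rw [abs_of_pos hxpos]; linarith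
  have hxabs' : |(-x)| < 1 / 224 := by rw [abs_neg]; exact hxabs
  have hp := abs_profile_one_sub_le h1 h2 hxabs
  have hm := abs_profile_one_sub_le h1 h2 hxabs'
  refine ⟨(profile r 1 x - 1 - (1 - r) * x) / x, (profile r 1 (-x) - 1 - (1 - r) * (-x)) / x,
    ?_, ?_, ?_, ?_⟩
  · rw [abs_div, abs_of_pos hxpos, div_le_iff₀ hxpos]
    calc |profile r 1 x - 1 - (1 - r) * x| ≤ 30106 * x ^ 2 := hp
      _ = 30106 * x * x := by ring
  · rw [abs_div, abs_of_pos hxpos, div_le_iff₀ hxpos]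
    calc |profile r 1 (-x) - 1 - (1 - r) * -x| ≤ 30106 * (-x) ^ 2 := hm
      _ = 30106 * x * x := by ring
  · rw [germ_fst, ← hx, Real.exp_neg, ← hx]
    field_simp
    ring
  · rw [germ_snd, ← hx, Real.exp_neg, ← hx]
    field_simp
    ring

/-- [folklore] -/
theorem q_le (h1 : 11 / 10 ≤ r) (h2 : r ≤ 28 / 25) : q r ≤ 79 / 100 := by
  have hr : r < rstar := by linarith [r3_r4_mem.2.2, r4_bounds.1]
  have hq := q_sq (disc_pos hr).le
  have hq0 := q_nonneg r
  nlinarith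

/-- **The far field of the `P₀` germ, uniformly in `r`**: for `r ∈ [11/10, 28/25]` and `ξ ≤ −16`
the germ is off the sonic lines (`D_W > 0`, `D_Z ≤ −1`), has `W ≥ 20 ≥ W₀` and satisfies the
triangle condition `(W − W₀) + (Z − Z₀) ≥ 0` of Prop. 2.5.
[cite: BuckmasterCaolaboraGomezserrano2025, Prop. 2.5 (proof)] -/
theorem germ_entry (h1 : 11 / 10 ≤ r) (h2 : r ≤ 28 / 25) {ξ : ℝ} (hξ : ξ ≤ ξA) :
    0 < DW (germ r ξ).1 (germ r ξ).2 ∧ DZ (germ r ξ).1 (germ r ξ).2 ≤ -1 ∧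
      20 ≤ (germ r ξ).1 ∧ W0 r ≤ (germ r ξ).1 ∧
      0 ≤ ((germ r ξ).1 - W0 r) + ((germ r ξ).2 - Z0 r) := by
  obtain ⟨Ep, Em, hEp, hEm, eW, eZ⟩ := germ_decomp h1 h2 hξ
  set x : ℝ := Real.exp ξ with hx
  have hxpos : 0 < x := Real.exp_pos ξ
  have hxlt : x < 1 / 8000000 := exp_lt_of_le hξ
  have hy : (8000000 : ℝ) < 1 / x := by rw [lt_div_iff₀ hxpos]; nlinarith
  have hEp' : |Ep| ≤ 1 / 100 := hEp.trans (by nlinarith)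
  have hEm' : |Em| ≤ 1 / 100 := hEm.trans (by nlinarith)
  have hEp1 := (abs_le.mp hEp').1; have hEp2 := (abs_le.mp hEp').2
  have hEm1 := (abs_le.mp hEm').1; have hEm2 := (abs_le.mp hEm').2
  have hq := q_le h1 h2
  have hq0 := q_nonneg r
  rw [eW, eZ]
  unfold DW DZ W0 Z0
  refine ⟨by nlinarith, by nlinarith, by nlinarith, by nlinarith, by nlinarith⟩

/-- `e^ξ` is inside the radius of the origin series for `ξ ≤ ξ_A`. [folklore] -/
theorem exp_lt_rad (h1 : 11 / 10 ≤ r) (h2 : r ≤ 28 / 25) {ξ : ℝ} (hξ : ξ ≤ ξA) :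
    |Real.exp ξ| < rad r 1 ∧ |(-Real.exp ξ)| < rad r 1 := by
  have h := exp_lt_of_le hξ
  have hr := rad_ge (r := r) (by linarith) h2
  have ha : |Real.exp ξ| < rad r 1 := by
    rw [abs_of_pos (Real.exp_pos ξ)]; linarith
  exact ⟨ha, by rwa [abs_neg]⟩

/-- **The germ solves (1.8)** (resolved form) for `ξ ≤ ξ_A`, uniformly in `r ∈ [11/10, 28/25]`.
[cite: BuckmasterCaolaboraGomezserrano2025, Prop. 2.5, eqs. (1.8)–(1.10)] -/
theorem germ_hasDerivAt (h1 : 11 / 10 ≤ r) (h2 : r ≤ 28 / 25) {ξ : ℝ} (hξ : ξ ≤ ξA) :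
    HasDerivAt (germ r) (field r (germ r ξ)) ξ := by
  obtain ⟨_, _, _, hdiff, hode⟩ := originSeries_input (r := r) one_pos
  obtain ⟨ha, ha'⟩ := exp_lt_rad h1 h2 hξ
  obtain ⟨hDW, hDZ, _⟩ := germ_entry h1 h2 hξ
  have hpos : 0 < Real.exp ξ := Real.exp_pos ξ
  have e2 := hode (-Real.exp ξ) (neg_ne_zero.mpr hpos.ne') ha'
  simp only [neg_neg] at e2
  exact hasDerivAt_WZofProfile (hdiff _ ha) (hdiff _ ha') (hode _ hpos.ne' ha) e2 hDW.ne'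
    (by linarith : DZ (germ r ξ).1 (germ r ξ).2 ≠ 0)

/-- The germ is continuous on `(−∞, ξ_A]`. [folklore] -/
theorem germ_continuousAt (h1 : 11 / 10 ≤ r) (h2 : r ≤ 28 / 25) {ξ : ℝ} (hξ : ξ ≤ ξA) :
    ContinuousAt (germ r) ξ :=
  (germ_hasDerivAt h1 h2 hξ).continuousAt

end Germ

end Monatomic

end BuckmasterCaolaboraGomezserrano2025

end Literature.Analysis.FluidPDE
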